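import Mathlib
import Summits.ValiantsHypothesis.ValiantsHypothesis.Theorems.LacunarySymmetroidMatrixDescartesCensusDefs
import Summits.ValiantsHypothesis.ValiantsHypothesis.Theorems.LacunarySymmetroidMatrixDescartesCensusCertificates
import Summits.ValiantsHypothesis.ValiantsHypothesis.Theorems.LacunarySymmetroidMatrixDescartesDegreeCeiling
import Summits.ValiantsHypothesis.ValiantsHypothesis.Theorems.LacunarySymmetroidMatrixDescartesStubDescartesCeiling
import Summits.ValiantsHypothesis.ValiantsHypothesis.Theorems.LacunarySymmetroidMatrixDescartesFiniteSectorDefs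
import Literature.Computability.AlgebraicComplexity.RealTauKnownCases

/-!
# `MatrixDescartes` — line «finite» ported: T1 (certificate ⇒ sector), T2 (DOUBLING `X ↦ X²`), T3 (POSTAGE-STAMP
# ceiling), the GAP RULE in the sector with its SIEVE, and «H3 ⇒ stamp non-realisability»

HONEST FRAMING.  Port (desk pub-symmetroid R2428 (C); porter val-sym-eng-3 g3) of the PROVED part of the crux workfile
`Cruxes/MatrixDescartes/Lines/finite.lean` (val-idea-6 g3, lens = reduction-to-finite; val-idea-crit-2 VERDICT #23 =
PASS, instrument + structure tier, no law posited; director-valiant g11-R9).  Statements and proofs are the workfile's,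
verbatim up to the namespace and the shared vocabulary file `…FiniteSectorDefs` (`pencil`, `IsRealRootedSimple`,
`HypRootLawAt`, `IsFullPosRooted`, `StampLawAt`, `HyperbolicLaw`, `StampNonRealisability`); the workfile's wrapper
`def GapRule`/`gapRule_holds` is dropped (the theorem `gapRule` is the content).  The crux
`Summit.ValiantsHypothesis.ValiantsHypothesis.Theses.LacunarySymmetroid.MatrixDescartes` (`stmt-ValiantsHypothesis-18050`)
is asymptotic in `K`; this file proves NOTHING toward it and nothing about `VP ≠ VNP`; `HyperbolicLaw` enters only as
a hypothesis.  The workfile's existential search targets F4–F7 (sorried stubs for the engines) are NOT ported; the four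
kernel certificate rows `¬ HypRootLawAt 2 4 15 / 2 5 23 / 2 6 27 / 3 4 23` are in the companion
`…FiniteSectorCertificates.lean` (400-line rule).

* **T1 (certificate ⇒ sector).**  `natDegree_eq_and_card_eq_of_alternating`: exponents `≤ D` (tree
  `DegreeCeiling.natDegree_det_pencil_le`: `deg ≤ m·D`) and `m·D + 1` strictly increasing reals with alternating
  determinant signs (tree `Census.le_card_roots_pencil_of_alternating`: `Z ≥ m·D`) force `deg = Z = m·D`: the pencil is IN
  the sector, of known degree; so ONE rational certificate decides a sector cell from below (`not_hypRootLawAt_of_alternating`).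
* **T2 (DOUBLING).**  `det (∑ X^(2 d l) • S l) = expand 2 (det (∑ X^(d l) • S l))` (`det_pencil_double`); a
  FULL-POSITIVE-ROOTED half-pencil determinant `q` gives `q(X²)` in the sector with twice the degree
  (`isRealRootedSimple_double`), so `ν(m,K) ≥ n ⇒ η(m,K) ≥ 2n` (`not_hypRootLawAt_of_fullPos`) and
  `η(m,K) ≤ 2B + 1 ⇒ ν(m,K) ≤ B` (`stampLawAt_of_hypRootLawAt`).
* **T3 (POSTAGE-STAMP CEILING).**  Full positive-rootedness forces every coefficient `0 … n` to be non-zero (Descartes: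
  Mathlib `roots_countP_pos_le_signVariations` + Literature `signVariations_lt_card_support`), and `supp det ⊆ m`-fold sumset
  of the exponents (tree `StubDescartesCeiling.support_det_pencil_subset`); hence `[0, n] ⊆ m·E` (`mem_sumset_of_fullPos`):
  `ν(m,K) ≤ n(m, K−1)`, the classical postage-stamp number.
* **GAP RULE** (`gapRule`, Rolle induction; Pólya–Szegő II, Part V) and **SIEVE** (`sieve`, `natDegree_mem_sumset`): in the
  sector `supp det` is a chain with steps `≤ 2` inside `m·E` — whence the workfile's computed caps `η(m,K) ≤ σ(m,K)`
  (finite enumeration, not ported).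
* **H3 ⇒ StampNonRealisability** (`stampNonRealisability_of_hyperbolicLaw`, by T2).
[folklore] throughout (IVT at rational points, degree count, Descartes' rule, `X ↦ X²`, Rolle).
-/

-- `Summit.ValiantsHypothesis.ValiantsHypothesis.…` repeats a component by the D-0017 layout
-- (single-conjunct summit), which the `dupNamespace` linter flags; the name is mandated.
set_option linter.dupNamespace false

noncomputable section

namespace Summit.ValiantsHypothesis.ValiantsHypothesis.Theorems.LacunarySymmetroidMatrixDescartes.FiniteSector

open Summit.ValiantsHypothesis.ValiantsHypothesis.Theorems.LacunarySymmetroidMatrixDescartes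
  (RealRootLawAt)
open Summit.ValiantsHypothesis.ValiantsHypothesis.Theorems.LacunarySymmetroidMatrixDescartes.Census
  (le_card_roots_pencil_of_alternating not_realRootLawAt_of_witness)
open Summit.ValiantsHypothesis.ValiantsHypothesis.Theorems.LacunarySymmetroidMatrixDescartes.DegreeCeiling
  (natDegree_det_pencil_le)
open Summit.ValiantsHypothesis.ValiantsHypothesis.Theorems.LacunarySymmetroidMatrixDescartes.StubDescartesCeiling
  (support_det_pencil_subset)
open scoped BigOperators Matrix
open Polynomial

/-! ## §1 T1 — a rational alternation certificate of full length puts a pencil IN the sector -/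

/-- **T1.**  Exponents `≤ D` and `N + 1 = m·D + 1` strictly increasing reals along which `det (∑ l, t^(d l) S l)`
alternates in sign ⟹ `natDegree det = Z = m·D`.  By name: tree `DegreeCeiling.natDegree_det_pencil_le`
(`deg ≤ m·D`), tree `Census.le_card_roots_pencil_of_alternating` (`Z ≥ N`), Mathlib `card_roots'`. [folklore] -/
theorem natDegree_eq_and_card_eq_of_alternating {m K : ℕ} (d : Fin K → ℕ)
    (S : Fin K → Matrix (Fin m) (Fin m) ℝ) (D N : ℕ) (hN : N = m * D) (hD : ∀ l, d l ≤ D)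
    (τ : Fin (N + 1) → ℝ) (hτ : StrictMono τ)
    (halt : ∀ j : Fin N,
      (∑ l, τ j.castSucc ^ d l • S l).det * (∑ l, τ j.succ ^ d l • S l).det < 0) :
    (Matrix.det (∑ l, ((Polynomial.X : ℝ[X]) ^ d l) • (S l).map Polynomial.C)).natDegree = N ∧
    (Matrix.det (∑ l, ((Polynomial.X : ℝ[X]) ^ d l) • (S l).map Polynomial.C)).roots.toFinset.card = N := by
  have h1 : N ≤ (Matrix.det (∑ l, ((Polynomial.X : ℝ[X]) ^ d l) • (S l).map Polynomial.C)
      ).roots.toFinset.card := le_card_roots_pencil_of_alternating d S N τ hτ halt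
  have h2 : (Matrix.det (∑ l, ((Polynomial.X : ℝ[X]) ^ d l) • (S l).map Polynomial.C)).natDegree ≤ m * D :=
    natDegree_det_pencil_le d S D hD
  have h3 : (Matrix.det (∑ l, ((Polynomial.X : ℝ[X]) ^ d l) • (S l).map Polynomial.C)
      ).roots.toFinset.card ≤
      (Matrix.det (∑ l, ((Polynomial.X : ℝ[X]) ^ d l) • (S l).map Polynomial.C)).natDegree :=
    (Multiset.toFinset_card_le _).trans (Polynomial.card_roots' _)
  constructor <;> omega

/-- T1, sector form: the certified pencil is IN the sector. [folklore] -/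
theorem isRealRootedSimple_of_alternating {m K : ℕ} (d : Fin K → ℕ)
    (S : Fin K → Matrix (Fin m) (Fin m) ℝ) (D N : ℕ) (hN : N = m * D) (hD : ∀ l, d l ≤ D)
    (τ : Fin (N + 1) → ℝ) (hτ : StrictMono τ)
    (halt : ∀ j : Fin N,
      (∑ l, τ j.castSucc ^ d l • S l).det * (∑ l, τ j.succ ^ d l • S l).det < 0) :
    IsRealRootedSimple (pencil d S).det ∧ (pencil d S).det.natDegree = N := by
  obtain ⟨hdeg, hcard⟩ := natDegree_eq_and_card_eq_of_alternating d S D N hN hD τ hτ halt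
  exact ⟨hcard.trans hdeg.symm, hdeg⟩

/-- **T1 ⇒ the sector row is decided from below by one certificate**: `η(m,K) ≥ m·D`. [folklore] -/
theorem not_hypRootLawAt_of_alternating {m K B : ℕ} (d : Fin K → ℕ)
    (S : Fin K → Matrix (Fin m) (Fin m) ℝ) (hS : ∀ l, (S l).IsSymm) (D N : ℕ) (hN : N = m * D)
    (hD : ∀ l, d l ≤ D) (τ : Fin (N + 1) → ℝ) (hτ : StrictMono τ)
    (halt : ∀ j : Fin N,
      (∑ l, τ j.castSucc ^ d l • S l).det * (∑ l, τ j.succ ^ d l • S l).det < 0)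
    (hB : B < N) : ¬ HypRootLawAt m K B := fun h => by
  obtain ⟨hdeg, hcard⟩ := natDegree_eq_and_card_eq_of_alternating d S D N hN hD τ hτ halt
  have h1 : (Matrix.det (∑ l, ((Polynomial.X : ℝ[X]) ^ d l) • (S l).map Polynomial.C)).natDegree ≤ B :=
    h d S hS (hcard.trans hdeg.symm)
  omega

/-- The same certificate in the census currency (all real zeros): `M(m,K) ≥ N`. [folklore] -/
theorem not_realRootLawAt_of_alternating {m K B : ℕ} (d : Fin K → ℕ)
    (S : Fin K → Matrix (Fin m) (Fin m) ℝ) (hS : ∀ l, (S l).IsSymm) (N : ℕ)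
    (τ : Fin (N + 1) → ℝ) (hτ : StrictMono τ)
    (halt : ∀ j : Fin N,
      (∑ l, τ j.castSucc ^ d l • S l).det * (∑ l, τ j.succ ^ d l • S l).det < 0)
    (hB : B < N) : ¬ RealRootLawAt m K B :=
  not_realRootLawAt_of_witness d S hS (lt_of_lt_of_le hB (le_card_roots_pencil_of_alternating d S N τ hτ halt))

/-! ## §2 T2 — DOUBLING `X ↦ X²`: a full-positive-rooted half-pencil gives an in-sector pencil of twice the degree -/

/-- Doubling the exponents is applying `expand 2` entrywise. [folklore] -/
theorem pencil_double {m K : ℕ} (d : Fin K → ℕ) (S : Fin K → Matrix (Fin m) (Fin m) ℝ) :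
    (∑ l, ((Polynomial.X : ℝ[X]) ^ (2 * d l)) • (S l).map Polynomial.C)
      = (∑ l, ((Polynomial.X : ℝ[X]) ^ d l) • (S l).map Polynomial.C).map (Polynomial.expand ℝ 2) := by
  ext i j
  simp only [Matrix.map_apply, Matrix.sum_apply, Matrix.smul_apply, smul_eq_mul, map_sum, map_mul,
    map_pow, Polynomial.expand_X, Polynomial.expand_C, pow_mul]

/-- **`det F_{2d,S} = (det F_{d,S})(X²)`.** [folklore] -/
theorem det_pencil_double {m K : ℕ} (d : Fin K → ℕ) (S : Fin K → Matrix (Fin m) (Fin m) ℝ) :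
    (Matrix.det (∑ l, ((Polynomial.X : ℝ[X]) ^ (2 * d l)) • (S l).map Polynomial.C))
      = Polynomial.expand ℝ 2 (Matrix.det (∑ l, ((Polynomial.X : ℝ[X]) ^ d l) • (S l).map Polynomial.C)) := by
  rw [pencil_double, AlgHom.map_det]
  rfl

/-- `q(X²)` has at least twice as many distinct real roots as `q` has distinct positive roots (`±√r`). [folklore] -/
theorem two_mul_card_posRoots_le_card_roots_expand {q : ℝ[X]} (hq : q ≠ 0) :
    2 * (q.roots.filter (0 < ·)).toFinset.card ≤ (Polynomial.expand ℝ 2 q).roots.toFinset.card := by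
  set R := (q.roots.filter (0 < ·)).toFinset with hR
  have hq2 : Polynomial.expand ℝ 2 q ≠ 0 := (Polynomial.expand_ne_zero (by norm_num)).2 hq
  have hmemR : ∀ r ∈ R, 0 < r ∧ q.IsRoot r := by
    intro r hr
    rw [hR, Multiset.mem_toFinset, Multiset.mem_filter] at hr
    exact ⟨hr.2, (Polynomial.mem_roots hq).1 hr.1⟩
  have hroot : ∀ r ∈ R, ∀ x : ℝ, x ^ 2 = r → x ∈ (Polynomial.expand ℝ 2 q).roots.toFinset := by
    intro r hr x hx
    rw [Multiset.mem_toFinset, Polynomial.mem_roots hq2, Polynomial.IsRoot, Polynomial.expand_eval, hx]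
    exact (hmemR r hr).2
  have h1 : R.image Real.sqrt ⊆ (Polynomial.expand ℝ 2 q).roots.toFinset := by
    intro x hx
    obtain ⟨r, hr, rfl⟩ := Finset.mem_image.1 hx
    exact hroot r hr _ (Real.sq_sqrt (hmemR r hr).1.le)
  have h2 : R.image (fun r => -Real.sqrt r) ⊆ (Polynomial.expand ℝ 2 q).roots.toFinset := by
    intro x hx
    obtain ⟨r, hr, rfl⟩ := Finset.mem_image.1 hx
    exact hroot r hr _ (by rw [neg_sq]; exact Real.sq_sqrt (hmemR r hr).1.le)
  have hinj1 : Set.InjOn Real.sqrt R := fun a ha b hb h =>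
    (Real.sqrt_inj (hmemR a ha).1.le (hmemR b hb).1.le).1 h
  have hinj2 : Set.InjOn (fun r => -Real.sqrt r) R := fun a ha b hb h =>
    hinj1 ha hb (neg_injective h)
  have hdisj : Disjoint (R.image Real.sqrt) (R.image fun r => -Real.sqrt r) := by
    rw [Finset.disjoint_left]
    intro x hx1 hx2
    obtain ⟨a, ha, rfl⟩ := Finset.mem_image.1 hx1
    obtain ⟨b, hb, hab⟩ := Finset.mem_image.1 hx2
    have ha' : 0 < Real.sqrt a := Real.sqrt_pos.2 (hmemR a ha).1
    have hb' : 0 ≤ Real.sqrt b := Real.sqrt_nonneg b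
    have hab' : -Real.sqrt b = Real.sqrt a := hab
    linarith
  calc 2 * R.card = (R.image Real.sqrt).card + (R.image fun r => -Real.sqrt r).card := by
        rw [Finset.card_image_of_injOn hinj1, Finset.card_image_of_injOn hinj2]; ring
    _ = (R.image Real.sqrt ∪ R.image fun r => -Real.sqrt r).card :=
        (Finset.card_union_of_disjoint hdisj).symm
    _ ≤ _ := Finset.card_le_card (Finset.union_subset h1 h2)

/-- **T2 (polynomial form).**  `q` full-positive-rooted ⟹ `q(X²)` in the sector, of degree `2 · natDegree q`.
[folklore] -/
theorem isRealRootedSimple_expand_of_fullPos {q : ℝ[X]} (hfull : IsFullPosRooted q) :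
    IsRealRootedSimple (Polynomial.expand ℝ 2 q) ∧ (Polynomial.expand ℝ 2 q).natDegree = 2 * q.natDegree := by
  by_cases hq : q = 0
  · subst hq
    simp [IsRealRootedSimple]
  have hdeg : (Polynomial.expand ℝ 2 q).natDegree = 2 * q.natDegree := by
    rw [Polynomial.natDegree_expand, mul_comm]
  refine ⟨?_, hdeg⟩
  unfold IsRealRootedSimple
  refine le_antisymm ((Multiset.toFinset_card_le _).trans (Polynomial.card_roots' _)) ?_
  rw [hdeg]
  unfold IsFullPosRooted at hfull
  rw [← hfull]
  exact two_mul_card_posRoots_le_card_roots_expand hq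

/-- **T2.**  If `det F_{d,S}` is full-positive-rooted then `det F_{2d,S}` is in the sector, of twice the degree.
[folklore] -/
theorem isRealRootedSimple_double {m K : ℕ} (d : Fin K → ℕ) (S : Fin K → Matrix (Fin m) (Fin m) ℝ)
    (hfull : IsFullPosRooted (Matrix.det (∑ l, ((Polynomial.X : ℝ[X]) ^ d l) • (S l).map Polynomial.C))) :
    IsRealRootedSimple (Matrix.det (∑ l, ((Polynomial.X : ℝ[X]) ^ (2 * d l)) • (S l).map Polynomial.C)) ∧
    (Matrix.det (∑ l, ((Polynomial.X : ℝ[X]) ^ (2 * d l)) • (S l).map Polynomial.C)).natDegree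
      = 2 * (Matrix.det (∑ l, ((Polynomial.X : ℝ[X]) ^ d l) • (S l).map Polynomial.C)).natDegree := by
  rw [det_pencil_double]
  exact isRealRootedSimple_expand_of_fullPos hfull

/-- **`ν(m,K) ≥ n ⇒ η(m,K) ≥ 2n`**: a full-positive-rooted half-pencil of degree `n` refutes the sector row
`2n − 1` (doubled exponents, same symmetric coefficients). [folklore] -/
theorem not_hypRootLawAt_of_fullPos {m K B : ℕ} (d : Fin K → ℕ) (S : Fin K → Matrix (Fin m) (Fin m) ℝ)
    (hS : ∀ l, (S l).IsSymm)
    (hfull : IsFullPosRooted (Matrix.det (∑ l, ((Polynomial.X : ℝ[X]) ^ d l) • (S l).map Polynomial.C)))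
    (hB : B < 2 * (Matrix.det (∑ l, ((Polynomial.X : ℝ[X]) ^ d l) • (S l).map Polynomial.C)).natDegree) :
    ¬ HypRootLawAt m K B := fun h => by
  obtain ⟨hsec, hdeg⟩ := isRealRootedSimple_double d S hfull
  have h1 : (Matrix.det (∑ l, ((Polynomial.X : ℝ[X]) ^ (2 * d l)) • (S l).map Polynomial.C)).natDegree ≤ B :=
    h (fun l => 2 * d l) S hS hsec
  omega

/-- **Sector row ⇒ stamp row**: `η(m,K) ≤ 2B + 1 ⇒ ν(m,K) ≤ B`. [folklore] -/
theorem stampLawAt_of_hypRootLawAt {m K B : ℕ} (h : HypRootLawAt m K (2 * B + 1)) : StampLawAt m K B := by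
  intro d S hS hfull
  by_contra hlt
  have hlt' : B < (Matrix.det (∑ l, ((Polynomial.X : ℝ[X]) ^ d l) • (S l).map Polynomial.C)).natDegree :=
    not_le.1 hlt
  exact not_hypRootLawAt_of_fullPos d S hS hfull (by omega) h

/-! ## §3 T3 — the POSTAGE-STAMP CEILING: full positive-rootedness forces `[0, deg] ⊆ m`-fold sumset of the exponents -/

/-- Descartes: `natDegree q` distinct positive roots force all `natDegree q + 1` coefficients to be non-zero.
(Mathlib `roots_countP_pos_le_signVariations`, Literature `signVariations_lt_card_support`.) [folklore] -/
theorem coeff_ne_zero_of_fullPos {q : ℝ[X]} (hq : q ≠ 0) (hfull : IsFullPosRooted q) {r : ℕ}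
    (hr : r ≤ q.natDegree) : q.coeff r ≠ 0 := by
  have h1 : q.natDegree ≤ q.roots.countP (0 < ·) := by
    rw [Multiset.countP_eq_card_filter]
    unfold IsFullPosRooted at hfull
    calc q.natDegree = (q.roots.filter (0 < ·)).toFinset.card := hfull.symm
      _ ≤ _ := Multiset.toFinset_card_le _
  have h2 : q.roots.countP (0 < ·) ≤ q.signVariations := Polynomial.roots_countP_pos_le_signVariations q
  have h3 : q.signVariations < q.support.card :=
    Literature.Computability.AlgebraicComplexity.signVariations_lt_card_support hq
  have h4 : q.support ⊆ Finset.range (q.natDegree + 1) := Polynomial.supp_subset_range_natDegree_succ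
  have h5 : q.support = Finset.range (q.natDegree + 1) :=
    Finset.eq_of_subset_of_card_le h4 (by rw [Finset.card_range]; omega)
  rw [← Polynomial.mem_support_iff, h5, Finset.mem_range]
  omega

/-- **T3 (postage-stamp ceiling).**  If `det F_{d,S} ≠ 0` is full-positive-rooted of degree `n`, every
`r ≤ n` is a sum of `m` exponents `d l` (with repetition): `[0, n] ⊆ m·E`.  Hence `ν(m,K) ≤ n(m, K−1)`, the
postage-stamp number (`m` stamps, `K − 1` denominations), and `η_even(m,K) = 2ν(m,K) ≤ 2 n(m,K−1)`.  (Tree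
`StubDescartesCeiling.support_det_pencil_subset`.) [folklore] -/
theorem mem_sumset_of_fullPos {m K : ℕ} (d : Fin K → ℕ) (S : Fin K → Matrix (Fin m) (Fin m) ℝ)
    (hq : Matrix.det (∑ l, ((Polynomial.X : ℝ[X]) ^ d l) • (S l).map Polynomial.C) ≠ 0)
    (hfull : IsFullPosRooted (Matrix.det (∑ l, ((Polynomial.X : ℝ[X]) ^ d l) • (S l).map Polynomial.C)))
    {r : ℕ}
    (hr : r ≤ (Matrix.det (∑ l, ((Polynomial.X : ℝ[X]) ^ d l) • (S l).map Polynomial.C)).natDegree) :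
    r ∈ (Finset.univ : Finset (Sym (Fin K) m)).image
      (fun s : Sym (Fin K) m => ((s : Multiset (Fin K)).map d).sum) :=
  support_det_pencil_subset d S
    (Polynomial.mem_support_iff.2 (coeff_ne_zero_of_fullPos hq hfull hr))

/-! ## §4 The GAP RULE in the sector (Rolle induction) and the SIEVE -/

/-- In the sector the root multiset is the full, duplicate-free list of `natDegree p` reals. [folklore] -/
theorem card_roots_of_sector {p : ℝ[X]} (h : IsRealRootedSimple p) :
    Multiset.card p.roots = p.natDegree ∧ p.roots.Nodup := by
  have h1 : p.roots.toFinset.card ≤ Multiset.card p.roots := Multiset.toFinset_card_le _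
  have h2 : Multiset.card p.roots ≤ p.natDegree := Polynomial.card_roots' p
  unfold IsRealRootedSimple at h
  refine ⟨by omega, ?_⟩
  rw [← Multiset.toFinset_card_eq_card_iff_nodup]
  omega

/-- **The sector is closed under differentiation** (Rolle: Mathlib `card_roots_toFinset_le_derivative`), and the
derivative drops the degree by exactly one. [folklore] -/
theorem sector_derivative {p : ℝ[X]} (h : IsRealRootedSimple p) :
    IsRealRootedSimple (derivative p) ∧ (derivative p).natDegree = p.natDegree - 1 := by
  unfold IsRealRootedSimple at *
  have h1 := Polynomial.card_roots_toFinset_le_derivative p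
  have h2 : (derivative p).roots.toFinset.card ≤ (derivative p).natDegree :=
    (Multiset.toFinset_card_le _).trans (Polynomial.card_roots' _)
  have h3 : (derivative p).natDegree ≤ p.natDegree - 1 := Polynomial.natDegree_derivative_le p
  constructor <;> omega

/-- **GAP RULE** (classical — a polynomial with only real zeros has no two consecutive vanishing coefficients
between its extreme ones; Pólya–Szegő, *Problems and Theorems in Analysis* II, Part V; here in the sector, where
the zeros are moreover simple and a zero at the origin is at most simple): for every `r` with `r + 2 ≤ deg p`,
one of `a_r, a_{r+1}` is non-zero.  Proof: `r = 0` — `a₀ = a₁ = 0` makes `0` a double root; `r + 1` — pass to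
`p'` (in the sector by `sector_derivative`) and use `a'_r = (r+1) a_{r+1}`. [folklore] -/
theorem gapRule : ∀ (r : ℕ) (p : ℝ[X]), p ≠ 0 → IsRealRootedSimple p → r + 2 ≤ p.natDegree →
    p.coeff r ≠ 0 ∨ p.coeff (r + 1) ≠ 0 := by
  intro r
  induction r with
  | zero =>
    intro p hp hsec hdeg
    by_contra h
    obtain ⟨h0, h1⟩ := not_or.1 h
    have h0 : p.coeff 0 = 0 := not_not.1 h0
    have h1 : p.coeff (0 + 1) = 0 := not_not.1 h1
    have hdvd : (X - C (0 : ℝ)) ^ 2 ∣ p := by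
      rw [map_zero, sub_zero, Polynomial.X_pow_dvd_iff]
      intro d hd
      interval_cases d <;> assumption
    have hmult : 2 ≤ p.rootMultiplicity 0 := (Polynomial.le_rootMultiplicity_iff hp).2 hdvd
    have hnodup := (card_roots_of_sector hsec).2
    have hcount := Multiset.nodup_iff_count_le_one.1 hnodup 0
    rw [Polynomial.count_roots] at hcount
    omega
  | succ r ih =>
    intro p hp hsec hdeg
    have hp' : derivative p ≠ 0 := by
      intro h0
      have := Polynomial.derivative_eq_zero.1 h0
      omega
    obtain ⟨hsec', hdeg'⟩ := sector_derivative hsec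
    have hr : r + 2 ≤ (derivative p).natDegree := by omega
    rcases ih (derivative p) hp' hsec' hr with h | h
    · left
      rw [Polynomial.coeff_derivative] at h
      exact left_ne_zero_of_mul h
    · right
      rw [Polynomial.coeff_derivative] at h
      exact left_ne_zero_of_mul h

/-- **SIEVE.**  In the sector, of any two consecutive exponents below the degree at least one is an `m`-fold sum of
the pencil's exponents (gap rule + tree `support_det_pencil_subset`); together with `natDegree ∈ m·E`
(`natDegree_mem_sumset`) this makes `supp det` a chain with steps `≤ 2` from `{0,1}` to `natDegree` inside `m·E`,
whence the computed caps `η(m,K) ≤ σ(m,K)` of the header (finite enumeration, `instr/stamp.py`). [folklore] -/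
theorem sieve {m K : ℕ} (d : Fin K → ℕ) (S : Fin K → Matrix (Fin m) (Fin m) ℝ)
    (hq : Matrix.det (∑ l, ((Polynomial.X : ℝ[X]) ^ d l) • (S l).map Polynomial.C) ≠ 0)
    (hsec : IsRealRootedSimple (Matrix.det (∑ l, ((Polynomial.X : ℝ[X]) ^ d l) • (S l).map Polynomial.C)))
    {r : ℕ}
    (hr : r + 2 ≤ (Matrix.det (∑ l, ((Polynomial.X : ℝ[X]) ^ d l) • (S l).map Polynomial.C)).natDegree) :
    r ∈ (Finset.univ : Finset (Sym (Fin K) m)).image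
        (fun s : Sym (Fin K) m => ((s : Multiset (Fin K)).map d).sum) ∨
      r + 1 ∈ (Finset.univ : Finset (Sym (Fin K) m)).image
        (fun s : Sym (Fin K) m => ((s : Multiset (Fin K)).map d).sum) := by
  rcases gapRule r _ hq hsec hr with h | h
  · exact Or.inl (support_det_pencil_subset d S (Polynomial.mem_support_iff.2 h))
  · exact Or.inr (support_det_pencil_subset d S (Polynomial.mem_support_iff.2 h))

/-- The top of the chain: `natDegree det ∈ m·E` for a non-zero determinant. [folklore] -/
theorem natDegree_mem_sumset {m K : ℕ} (d : Fin K → ℕ) (S : Fin K → Matrix (Fin m) (Fin m) ℝ)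
    (hq : Matrix.det (∑ l, ((Polynomial.X : ℝ[X]) ^ d l) • (S l).map Polynomial.C) ≠ 0) :
    (Matrix.det (∑ l, ((Polynomial.X : ℝ[X]) ^ d l) • (S l).map Polynomial.C)).natDegree ∈
      (Finset.univ : Finset (Sym (Fin K) m)).image
        (fun s : Sym (Fin K) m => ((s : Multiset (Fin K)).map d).sum) :=
  support_det_pencil_subset d S (Polynomial.natDegree_mem_support_of_nonzero hq)

/-! ## §5 H3 read through the dictionary: in the all-even sub-sector H3 is a NON-REALISABILITY statement (glue) -/

/-- **H3 ⇒ stamp non-realisability** (doubling, T2). [folklore] -/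
theorem stampNonRealisability_of_hyperbolicLaw (h : HyperbolicLaw) : StampNonRealisability := by
  intro c
  obtain ⟨K₀, hK₀⟩ := h c
  refine ⟨K₀, fun K m hK hm d S hS hfull => ?_⟩
  obtain ⟨hsec, hdeg⟩ := isRealRootedSimple_double d S hfull
  have h1 : (Matrix.det (∑ l, ((Polynomial.X : ℝ[X]) ^ (2 * d l)) • (S l).map Polynomial.C)).natDegree ^ 2
      ≤ 2 ^ (K * Nat.log 2 K) := hK₀ K m hK hm (fun l => 2 * d l) S hS hsec
  rw [hdeg] at h1
  exact h1

end Summit.ValiantsHypothesis.ValiantsHypothesis.Theorems.LacunarySymmetroidMatrixDescartes.FiniteSector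

end
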